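import Mathlib.RingTheory.Valuation.ValuationSubring
import Mathlib.RingTheory.LocalRing.ResidueField.Basic
import Mathlib.RingTheory.AlgebraicIndependent.TranscendenceBasis
import Mathlib.RingTheory.AlgebraicIndependent.AlgebraicClosure
import Mathlib.RingTheory.MvPolynomial.Tower
import Mathlib.LinearAlgebra.Dimension.Localization
import Mathlib.SetTheory.Cardinal.Arithmetic
import HarnessLib

/-!
# Rational rank, dimension and transcendence defect of a valued field; Abhyankar's inequality

Topic: `Literature/AlgebraicGeometry/Resolution`. Vocabulary of M. Temkin, *Inseparable local
uniformization*, J. Algebra 373 (2013) 65–119 = arXiv:0804.1554v3, §2.1 (pp. 9–10), for a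
valued field `(K, O)` — `O : ValuationSubring K`, i.e. `O = K°` — over a TRIVIALLY VALUED
subfield `k` (`k ⊆ O`; the setting of Temkin's Thm. 1.3.2 and Thm. 4.1.1, whose ground field `k`
is trivially valued), and the one classical theorem about it that the paper uses without proof:

* `ratRank O` — the **rational rank** `E_{K/k} = dim_ℚ((|K^×|/|k^×|) ⊗ ℚ)` (p. 9); for trivially
  valued `k`, `|k^×| = 1` and this is the rank of the value group `Γ_O = K^×/O^×`, rendered as
  the `ℤ`-rank of `Γ_O` (the units of Mathlib's `ValuationSubring.ValueGroup O`, which is a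
  group with zero), and equal to `dim_ℚ(Γ_O ⊗ ℚ)` (`rank_rat_tensor_valueGroup`, PROVED).
* `residueTrdeg k O hk` — the **dimension** `F_{K/k} = tr.deg._{k̃}(K̃)` (p. 9), the
  transcendence degree of the residue field `K̃ = O/𝔪_O` over `k = k̃`.
* `transcendenceDefect k O hk` — the **transcendence defect** `D_{K/k} = N - E - F`,
  `N = tr.deg._k(K)` (p. 10), as a natural number (the source defines it for finite `N` only,
  which is the case `K/k` finitely generated of Thm. 1.3.2; `transcendenceDefect_add_eq`:
  `D + E + F = N` whenever `N < ℵ₀`; `transcendenceDefect_eq_zero_iff`: `D = 0 ↔ E + F = N`).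
  For finite `N`, `D = 0` is Temkin's numerical characterisation of the **Abhyankar**
  (transcendentally defectless) extensions (p. 10: "for a finite `N` the extension is Abhyankar
  if and only if `D_{l/k} = 0`"); the Abhyankar predicate itself (existence of a transcendence
  basis satisfying condition (*) of p. 9) is NOT rendered here. The proof of Temkin's
  Thm. 4.1.1 is an induction on `D` (p. 47, Step 0).
* `algebraicIndependent_sumElim_of_valuation` — PROVED: elements `x_i ∈ O` with residues
  algebraically independent over `k` together with elements `y_j ∈ K^×` whose values are
  `ℤ`-independent in `Γ_O` (equivalently: distinct monomials in the `y_j` have distinct values,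
  `injective_valuation_prod_pow`) are algebraically independent over `k` (p. 10: "We omit a
  rather straightforward check that the elements of `B` are algebraically independent over `k`";
  Knaf–Kuhlmann 2005, Thm. 2.1: "For its proof see [B], Chapter VI, 10.3, Theorem 1"). Proof: a
  non-zero polynomial over `k` in the `x_i` is a unit of `O` (`valuation_aeval_eq_one`), so in
  `∑_μ c_μ(x) y^μ` the non-zero terms have pairwise distinct values and the sum has the largest
  of them (ultrametric inequality), hence is non-zero.
* `ratRank_add_residueTrdeg_le_trdeg` — PROVED: **Abhyankar's inequality** `E + F ≤ N` as an
  inequality of cardinals (p. 10: "It follows, in particular, that `E + F` cannot exceed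
  `N = tr.deg._k(l)`"; Knaf–Kuhlmann 2005, §2, after Thm. 2.1: "`ρ + τ ≤ trdeg F|K`. This
  proves that `trdeg FP|KP` and the rational rank of `v_P F/v_P K` are finite"), with the
  finiteness consequences
  `ratRank_lt_aleph0`, `residueTrdeg_lt_aleph0` for `N < ℵ₀` (`trdeg_lt_aleph0_of_fg`: `N < ℵ₀`
  for `K/k` finitely generated).

## Sources

* M. Temkin, *Inseparable local uniformization*, J. Algebra 373 (2013) 65–119 =
  arXiv:0804.1554v3, §2.1 "Valued fields", pp. 9–10 (invariants `E`, `F`, `D`, Abhyankar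
  extensions, Remarks 2.1.2–2.1.3); proof of Thm. 4.1.1, Step 0 (p. 47). Quotations follow
  the wording of this version (= the journal's): "transcendence defect", "transcendentally
  immediate/defectless"; arXiv v1/v2 say "defect rank" and "essentially immediate/defectless"
  for the same notions.
* H. Knaf, F.-V. Kuhlmann, *Abhyankar places admit local uniformization in any
  characteristic*, Ann. Sci. ÉNS 38 (2005) 833–846 = arXiv:math/0304159, §2 "Valuation
  independence": Thm. 2.1 (with the pointer "For its proof see [B], Chapter VI, 10.3,
  Theorem 1", i.e. N. Bourbaki, *Algèbre commutative*, Ch. VI §10, no. 3, Thm. 1) and the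
  paragraph after it (the inequality `ρ + τ ≤ trdeg F|K`).

## Rendering notes

* "`k` trivially valued, `k ⊆ K` an extension of valued fields" ↦ `[Algebra k K]`,
  `O : ValuationSubring K` and `hk : ∀ c : k, algebraMap k K c ∈ O` (as in the named facts
  `Temkin2013`, `Temkin2013Relative`, `Temkin2013Descent`); the induced `k`-algebra structure on
  `O` is `algebraOfMem k O hk`, and `residueTrdeg`/`transcendenceDefect` take `hk` explicitly
  (`residueTrdeg_eq`: any compatible `[Algebra k O] [IsScalarTower k O K]` computes the same).
* The value group: Mathlib's `ValuationSubring.ValueGroup O` is `K/O^×` WITH zero; the value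
  group `Γ_O = K^×/O^×` of the source is its group of units, written additively
  (`Additive (ValueGroup O)ˣ`) when regarded as a `ℤ`-module.
* `D` is rendered in `ℕ` with truncated subtraction of `Cardinal.toNat`s; by Abhyankar's
  inequality this is faithful exactly when `N < ℵ₀`, the only case in which the source defines
  `D` by this formula (Remark 2.1.2 defines it in general as `tr.deg._{k(B)}(l)`; not rendered).
-/

noncomputable section

open IsLocalRing MvPolynomial Cardinal

namespace Literature.AlgebraicGeometry.Resolution

universe u v

variable {K : Type v} [Field K]

/-! ### The invariants `E`, `F`, `D` -/

/-- The **rational rank** `E_{K/k}` of a valuation ring `O = K°` of `K` over a trivially valued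
subfield `k ⊆ O` (Temkin 2013, §2.1, p. 9: "`E = E_{l/k} = dim_ℚ(|l^×|/|k^×| ⊗_ℤ ℚ)` … Sometimes
these cardinals are called the rational rank and the dimension"; for trivially valued `k` one
has `|k^×| = 1`). Rendered as the rank of the value group `Γ_O = K^×/O^×` — the group of units
of Mathlib's value group with zero `ValuationSubring.ValueGroup O` — as a `ℤ`-module, which is
`dim_ℚ(Γ_O ⊗ ℚ)` (`rank_rat_tensor_valueGroup`). It does not depend on `k`.
[cite: Temkin2013, Section 2.1 (p. 9)] -/
def ratRank (O : ValuationSubring K) : Cardinal.{v} :=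
  Module.rank ℤ (Additive (ValuationSubring.ValueGroup O)ˣ)

/-- `E = dim_ℚ(Γ_O ⊗_ℤ ℚ)`, the printed form of the rational rank. [folklore] -/
theorem rank_rat_tensor_valueGroup (O : ValuationSubring K) :
    Module.rank ℚ (TensorProduct ℤ ℚ (Additive (ValuationSubring.ValueGroup O)ˣ)) = ratRank O :=
  (TensorProduct.isBaseChange ℤ (Additive (ValuationSubring.ValueGroup O)ˣ) ℚ).rank_eq

variable (k : Type u) [Field k] [Algebra k K]

/-- The `k`-algebra structure on a valuation ring `O` of `K` containing (the image of) `k`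
(a trivially valued ground field: Temkin 2013, Thm. 1.3.2, "`k` is trivially valued").
[folklore] -/
abbrev algebraOfMem (O : ValuationSubring K) (hk : ∀ c : k, algebraMap k K c ∈ O) : Algebra k O :=
  ((algebraMap k K).codRestrict O hk).toAlgebra

/-- `algebraOfMem` is compatible with `k → K`. [folklore] -/
theorem isScalarTower_algebraOfMem (O : ValuationSubring K) (hk : ∀ c : k, algebraMap k K c ∈ O) :
    letI := algebraOfMem k O hk
    IsScalarTower k O K :=
  letI := algebraOfMem k O hk
  IsScalarTower.of_algebraMap_eq fun _ => rfl

/-- The **dimension** (residual transcendence degree) `F_{K/k} = tr.deg._{k̃}(K̃)` of a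
valuation ring `O = K°` of `K` over a trivially valued subfield `k ⊆ O` (Temkin 2013, §2.1,
p. 9), i.e. the transcendence degree over `k` (`= k̃`, `k` being trivially valued) of the
residue field `K̃ = O/𝔪_O`. [cite: Temkin2013, Section 2.1 (p. 9)] -/
def residueTrdeg (O : ValuationSubring K) (hk : ∀ c : k, algebraMap k K c ∈ O) : Cardinal.{v} :=
  letI := algebraOfMem k O hk
  Algebra.trdeg k (ResidueField O)

/-- The **transcendence defect** `D_{K/k} = N - E - F` of a valuation ring `O = K°` of `K`
over a trivially valued subfield `k ⊆ O`, where `N = tr.deg._k(K)` (Temkin 2013, §2.1, p. 10: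
"It follows, in particular, that `E + F` cannot exceed `N = tr.deg._k(l)`, and when `N` is
finite we define the transcendence defect `D = D_{l/k} = N - E - F`"). Rendered in `ℕ` via
`Cardinal.toNat` and truncated subtraction; this is the printed `D` exactly when `N < ℵ₀` (the
only case in which the source defines it this way, and the only case used: `K/k` finitely
generated), by Abhyankar's inequality `ratRank_add_residueTrdeg_le_trdeg`
(`transcendenceDefect_add_eq`). [cite: Temkin2013, Section 2.1 (p. 10)] -/
def transcendenceDefect (O : ValuationSubring K) (hk : ∀ c : k, algebraMap k K c ∈ O) : ℕ :=
  Cardinal.toNat (Algebra.trdeg k K) - Cardinal.toNat (ratRank O) -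
    Cardinal.toNat (residueTrdeg k O hk)

/-! ### Algebraic independence of value-independent and residually independent families -/

section core

variable {k}
variable (O : ValuationSubring K) [Algebra k O] [IsScalarTower k O K]

/-- A non-zero polynomial over `k` evaluated at elements of `O` whose residues are algebraically
independent over `k` is a unit of `O` (has value `1`). [folklore] -/
theorem valuation_aeval_eq_one {ι : Type*} (x : ι → O)
    (hx : AlgebraicIndependent k fun i => residue O (x i)) {P : MvPolynomial ι k} (hP : P ≠ 0) :
    O.valuation (aeval (fun i => (x i : K)) P) = 1 := by
  have h1 : aeval (fun i => (x i : K)) P = ((aeval x P : O) : K) :=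
    aeval_algebraMap_apply K x P
  rw [h1, ← ValuationSubring.valuation_eq_one_iff]
  by_contra hu
  have hmem : aeval x P ∈ maximalIdeal O := hu
  have hres : residue O (aeval x P) = 0 := (residue_eq_zero_iff _).mpr hmem
  have h2 : aeval (fun i => residue O (x i)) P = 0 := by
    have := comp_aeval_apply x (IsScalarTower.toAlgHom k O (ResidueField O)) P
    simp only [IsScalarTower.coe_toAlgHom', ResidueField.algebraMap_eq] at this
    rw [← this, hres]
  exact hP ((algebraicIndependent_iff.mp hx) P h2)

/-- Elements of `O` with algebraically independent residues are algebraically independent.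
[folklore] -/
theorem algebraicIndependent_of_residue {ι : Type*} (x : ι → O)
    (hx : AlgebraicIndependent k fun i => residue O (x i)) :
    AlgebraicIndependent k fun i => (x i : K) := by
  rw [algebraicIndependent_iff]
  intro P hP
  by_contra hne
  have h := valuation_aeval_eq_one O x hx hne
  rw [hP, map_zero] at h
  exact zero_ne_one h

/-- Non-zero elements of `k[x]`, for `x` with algebraically independent residues, have value `1`.
[folklore] -/
theorem valuation_eq_one_of_mem_adjoin {ι : Type*} (x : ι → O)
    (hx : AlgebraicIndependent k fun i => residue O (x i)) {r : K}
    (hr : r ∈ Algebra.adjoin k (Set.range fun i => (x i : K))) (hr0 : r ≠ 0) :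
    O.valuation r = 1 := by
  rw [Algebra.adjoin_range_eq_range_aeval, AlgHom.mem_range] at hr
  obtain ⟨P, rfl⟩ := hr
  have hP : P ≠ 0 := by
    rintro rfl
    exact hr0 (map_zero _)
  exact valuation_aeval_eq_one O x hx hP

omit [Algebra k O] [IsScalarTower k O K] in
/-- A family `y` of elements of `K` whose monomials have pairwise distinct values is
algebraically independent over any `k`-subalgebra `R ⊆ K` all of whose non-zero elements have
value `1` (ultrametric inequality: the value of `∑ c_μ y^μ` is the largest value of a term).
[folklore] -/
theorem algebraicIndependent_of_valuation {κ : Type*} (R : Subalgebra k K)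
    (hR : ∀ r ∈ R, r ≠ 0 → O.valuation r = 1) (y : κ → K)
    (hy : Function.Injective fun μ : κ →₀ ℕ => O.valuation (μ.prod fun j n => y j ^ n)) :
    AlgebraicIndependent R y := by
  classical
  -- the `y j` are non-zero (else `y_j¹` and `y_j²` would have the same value `0`)
  have hy0 : ∀ j, y j ≠ 0 := by
    intro j hj
    have h := @hy (Finsupp.single j 1) (Finsupp.single j 2)
      (by simp [Finsupp.prod_single_index, hj])
    have h' := DFunLike.congr_fun h j
    simp at h'
  rw [algebraicIndependent_iff]
  intro P hP
  by_contra hne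
  have hsupp : P.support.Nonempty := support_nonempty.mpr hne
  set t : (κ →₀ ℕ) → K := fun μ => algebraMap R K (coeff μ P) * μ.prod fun j n => y j ^ n
    with ht
  have haeval : aeval y P = ∑ μ ∈ P.support, t μ := by
    simp only [aeval_def, eval₂_eq, ht, Finsupp.prod]
  have hval : ∀ μ ∈ P.support, O.valuation (t μ) = O.valuation (μ.prod fun j n => y j ^ n) := by
    intro μ hμ
    have hc : ((coeff μ P : R) : K) ≠ 0 := by
      have : coeff μ P ≠ 0 := mem_support_iff.mp hμ
      exact fun h => this (Subtype.ext h)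
    have hRK : algebraMap R K (coeff μ P) = ((coeff μ P : R) : K) := rfl
    simp only [ht, map_mul, hRK, hR _ (coeff μ P).2 hc, one_mul]
  obtain ⟨μ₀, hμ₀, hmax⟩ :=
    P.support.exists_max_image (fun μ => O.valuation (μ.prod fun j n => y j ^ n)) hsupp
  have hlt : ∀ μ ∈ P.support \ {μ₀}, O.valuation (t μ) < O.valuation (t μ₀) := by
    intro μ hμ
    rw [Finset.mem_sdiff, Finset.mem_singleton] at hμ
    rw [hval μ hμ.1, hval μ₀ hμ₀]
    exact lt_of_le_of_ne (hmax μ hμ.1) fun h => hμ.2 (hy h)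
  have hsum : O.valuation (aeval y P) = O.valuation (t μ₀) := by
    rw [haeval]
    exact Valuation.map_sum_eq_of_lt _ hμ₀ hlt
  rw [hP, map_zero, hval μ₀ hμ₀] at hsum
  have hne0 : (μ₀.prod fun j n => y j ^ n) ≠ 0 :=
    Finset.prod_ne_zero_iff.mpr fun j _ => pow_ne_zero _ (hy0 j)
  exact ((Valuation.ne_zero_iff _).mpr hne0) hsum.symm

/-- **Algebraic independence of an Abhyankar-type system** (Temkin 2013, §2.1, pp. 9–10: for
`B = B_E ⊔ B_F` with `|b| = 1` for `b ∈ B_F`, the reduction mapping `B_F` bijectively onto an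
algebraically independent set of `K̃` over `k̃`, and the values of `B_E` independent in
`(|K^×|/|k^×|) ⊗ ℚ`, "the elements of `B` are algebraically independent over `k`";
Knaf–Kuhlmann 2005, Thm. 2.1: "Let `(F|K,P)` be an extension of valued fields. Take elements
`x_i, y_j ∈ F` such that the values `v_P x_i` are rationally independent over `v_P K`, and the
residues `y_j P` are algebraically independent over `KP`. Then the elements `x_i, y_j` are
algebraically independent over `K`. … For its proof see [B], Chapter VI, 10.3, Theorem 1"),
here for a trivially valued ground field `k ⊆ O` (`v_P K = 0`, `KP = k`): if `x : ι → O` has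
residues algebraically independent over `k` and the monomials in `y : κ → K^×` have pairwise
distinct values (⇐ values `ℤ`-independent, `injective_valuation_prod_pow`), then `(y, x)` is
algebraically independent over `k`. PROVED (ultrametric inequality).
[cite: KnafKuhlmann2005, Thm. 2.1] -/
theorem algebraicIndependent_sumElim_of_valuation {ι κ : Type*} (x : ι → O)
    (hx : AlgebraicIndependent k fun i => residue O (x i)) (y : κ → K)
    (hy : Function.Injective fun μ : κ →₀ ℕ => O.valuation (μ.prod fun j n => y j ^ n)) :
    AlgebraicIndependent k (Sum.elim y fun i => (x i : K)) :=
  (algebraicIndependent_of_residue O x hx).sumElim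
    (algebraicIndependent_of_valuation O _
      (fun _ hr hr0 => valuation_eq_one_of_mem_adjoin O x hx hr hr0) y hy)

omit [Algebra k O] [IsScalarTower k O K] in
/-- The unit of the value group defined by a non-zero element. [folklore] -/
theorem valuation_ne_zero_of_ne_zero {a : K} (ha : a ≠ 0) : O.valuation a ≠ 0 :=
  (Valuation.ne_zero_iff _).mpr ha

omit [Algebra k O] [IsScalarTower k O K] in
/-- **Values `ℤ`-independent ⇒ monomials have distinct values.** If the values
`v(y_j) ∈ Γ_O` of non-zero elements `y_j` are `ℤ`-linearly independent in the value group
(written additively), then distinct monomials in the `y_j` have distinct values. [folklore] -/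
theorem injective_valuation_prod_pow {κ : Type*} (y : κ → K) (hy0 : ∀ j, y j ≠ 0)
    (hli : LinearIndependent ℤ fun j =>
      Additive.ofMul (Units.mk0 (O.valuation (y j)) (valuation_ne_zero_of_ne_zero O (hy0 j)))) :
    Function.Injective fun μ : κ →₀ ℕ => O.valuation (μ.prod fun j n => y j ^ n) := by
  classical
  -- the unit-valued version of `μ ↦ v(y^μ)` is additive in `μ`
  set u : κ → (ValuationSubring.ValueGroup O)ˣ := fun j =>
    Units.mk0 (O.valuation (y j)) (valuation_ne_zero_of_ne_zero O (hy0 j)) with hu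
  have hprod : ∀ μ : κ →₀ ℕ, O.valuation (μ.prod fun j n => y j ^ n) =
      ((μ.prod fun j n => u j ^ n : (ValuationSubring.ValueGroup O)ˣ) :
        ValuationSubring.ValueGroup O) := by
    intro μ
    simp only [Finsupp.prod, map_prod, map_pow, Units.coe_prod, Units.val_pow_eq_pow_val,
      hu, Units.val_mk0]
  -- linear combination in `Additive Γ`
  have hlin : ∀ μ : κ →₀ ℕ, Additive.ofMul (μ.prod fun j n => u j ^ n) =
      Finsupp.linearCombination ℤ (fun j => Additive.ofMul (u j))
        (μ.mapRange (fun n : ℕ => (n : ℤ)) (by simp)) := by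
    intro μ
    rw [Finsupp.linearCombination_apply, Finsupp.sum_mapRange_index (fun _ => by simp)]
    simp only [Finsupp.prod, ofMul_prod, ofMul_pow, Finsupp.sum, natCast_zsmul]
  intro μ μ' h
  have h1 : (μ.prod fun j n => u j ^ n) = μ'.prod fun j n => u j ^ n := by
    apply Units.ext
    rw [← hprod, ← hprod]
    exact h
  have h2 := congrArg Additive.ofMul h1
  rw [hlin, hlin] at h2
  exact Finsupp.mapRange_injective _ (by simp) (fun a b hab => by exact_mod_cast hab)
    (hli.finsuppLinearCombination_injective h2)

end core

/-! ### Abhyankar's inequality `E + F ≤ N` -/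

section inequality

variable {k}

/-- A `ℤ`-independent set of values and an algebraically independent set of residues lift to an
algebraically independent family in `K`; hence `#s + #t ≤ tr.deg._k(K)`. [folklore] -/
theorem mk_add_mk_le_trdeg (O : ValuationSubring K) [Algebra k O] [IsScalarTower k O K]
    {s : Set (Additive (ValuationSubring.ValueGroup O)ˣ)} (hs : LinearIndepOn ℤ id s)
    {t : Set (ResidueField O)} (ht : AlgebraicIndepOn k id t) :
    #s + #t ≤ Algebra.trdeg k K := by
  classical
  -- lift the residues
  choose x hx using fun b : t => IsLocalRing.residue_surjective (b : ResidueField O)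
  -- lift the values
  choose y hy using fun a : s => O.valuation_surjective
    (((Additive.toMul (a : Additive (ValuationSubring.ValueGroup O)ˣ) :
      (ValuationSubring.ValueGroup O)ˣ) : ValuationSubring.ValueGroup O))
  have hy0 : ∀ a, y a ≠ 0 := by
    intro a h
    have := hy a
    rw [h, map_zero] at this
    exact (Units.ne_zero _) this.symm
  have hu : ∀ a, Units.mk0 (O.valuation (y a)) (valuation_ne_zero_of_ne_zero O (hy0 a)) =
      Additive.toMul (a : Additive (ValuationSubring.ValueGroup O)ˣ) := fun a => Units.ext (hy a)
  have hli : LinearIndependent ℤ fun a : s =>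
      Additive.ofMul (Units.mk0 (O.valuation (y a)) (valuation_ne_zero_of_ne_zero O (hy0 a))) := by
    have : (fun a : s => Additive.ofMul
        (Units.mk0 (O.valuation (y a)) (valuation_ne_zero_of_ne_zero O (hy0 a)))) =
        fun a : s => (a : Additive (ValuationSubring.ValueGroup O)ˣ) :=
      funext fun a => by rw [hu]; rfl
    rw [this]
    exact hs
  have hxt : AlgebraicIndependent k fun b : t => residue O (x b) := by
    have : (fun b : t => residue O (x b)) = fun b : t => (b : ResidueField O) := funext hx
    rw [this]
    exact ht
  have hind := algebraicIndependent_sumElim_of_valuation O x hxt y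
    (injective_valuation_prod_pow O y hy0 hli)
  simpa only [Cardinal.mk_sum, Cardinal.lift_id] using hind.cardinalMk_le_trdeg

/-- **Abhyankar's inequality** `E_{K/k} + F_{K/k} ≤ tr.deg._k(K)` for a valuation ring `O = K°`
of `K` and a trivially valued subfield `k ⊆ O` (Temkin 2013, §2.1, p. 10: "It follows, in
particular, that `E + F` cannot exceed `N = tr.deg._k(l)`"; Knaf–Kuhlmann 2005, §2, after
Thm. 2.1: "`ρ + τ ≤ trdeg F|K`"). PROVED, as an inequality of cardinals (no finiteness
needed): both sides are suprema, and each pair (independent set of values, independent set of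
residues) lifts to an algebraically independent family (`mk_add_mk_le_trdeg`).
[cite: Temkin2013, Section 2.1 (p. 10)] -/
theorem ratRank_add_residueTrdeg_le_trdeg (O : ValuationSubring K)
    (hk : ∀ c : k, algebraMap k K c ∈ O) :
    ratRank O + residueTrdeg k O hk ≤ Algebra.trdeg k K := by
  letI := algebraOfMem k O hk
  haveI := isScalarTower_algebraOfMem k O hk
  show Module.rank ℤ (Additive (ValuationSubring.ValueGroup O)ˣ) +
    Algebra.trdeg k (ResidueField O) ≤ _
  haveI : Nonempty {s : Set (Additive (ValuationSubring.ValueGroup O)ˣ) // LinearIndepOn ℤ id s} :=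
    ⟨⟨∅, linearIndepOn_empty ℤ id⟩⟩
  haveI : Nonempty {t : Set (ResidueField O) // AlgebraicIndepOn k id t} :=
    ⟨⟨∅, (algebraicIndependent_empty_type_iff.mpr (algebraMap k (ResidueField O)).injective)⟩⟩
  rw [Module.rank_def, Algebra.trdeg.eq_1 k (ResidueField O),
    Cardinal.ciSup_add_ciSup _ Cardinal.bddAbove_of_small _
      Cardinal.bddAbove_of_small]
  exact ciSup_le' fun s => ciSup_le' fun t => mk_add_mk_le_trdeg O s.2 t.2

/-- `residueTrdeg` computed with any compatible `k`-algebra structure on `O`. [folklore] -/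
theorem residueTrdeg_eq (O : ValuationSubring K) (hk : ∀ c : k, algebraMap k K c ∈ O)
    [inst : Algebra k O] [IsScalarTower k O K] :
    residueTrdeg k O hk = Algebra.trdeg k (ResidueField O) := by
  have h : algebraOfMem k O hk = inst := by
    refine Algebra.algebra_ext _ _ fun c => Subtype.ext ?_
    show algebraMap k K c = ((algebraMap k O c : O) : K)
    exact IsScalarTower.algebraMap_apply k O K c
  unfold residueTrdeg
  rw [h]

/-! ### Finiteness for finitely generated `K/k`, and `D + E + F = N` -/

omit [Algebra k K] in
/-- A finitely generated field extension has finite transcendence degree. [folklore] -/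
theorem trdeg_lt_aleph0_of_fg [Algebra k K] (hfg : (⊤ : IntermediateField k K).FG) :
    Algebra.trdeg k K < ℵ₀ := by
  classical
  obtain ⟨t, ht⟩ := hfg
  haveI hal : Algebra.IsAlgebraic (IntermediateField.adjoin k (t : Set K)) K := by
    refine ⟨fun x => ?_⟩
    have hx : x ∈ IntermediateField.adjoin k (t : Set K) := by rw [ht]; trivial
    exact isAlgebraic_algebraMap (⟨x, hx⟩ : IntermediateField.adjoin k (t : Set K))
  haveI : Algebra.IsAlgebraic (Algebra.adjoin k (t : Set K)) K :=
    IntermediateField.isAlgebraic_adjoin_iff_top.mp hal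
  exact (Algebra.IsAlgebraic.trdeg_le_cardinalMk k (t : Set K)).trans_lt
    (Cardinal.lt_aleph0_of_finite _)

variable (O : ValuationSubring K)

/-- `E < ℵ₀` when `tr.deg._k(K) < ℵ₀` — a consequence of Abhyankar's inequality
`ratRank_add_residueTrdeg_le_trdeg`. (For finitely generated ABHYANKAR `K/k` with `k` trivially
valued Temkin's Remark 2.1.3 says more — `|K^×|` is then a lattice of rank `E` —; in general the
value group of a finitely generated `K/k` need not be finitely generated, only `E < ℵ₀` holds.)
[folklore] -/
theorem ratRank_lt_aleph0 (hk : ∀ c : k, algebraMap k K c ∈ O) (hN : Algebra.trdeg k K < ℵ₀) :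
    ratRank O < ℵ₀ :=
  (le_self_add.trans (ratRank_add_residueTrdeg_le_trdeg O hk)).trans_lt hN

/-- `F < ℵ₀` when `tr.deg._k(K) < ℵ₀`. [folklore] -/
theorem residueTrdeg_lt_aleph0 (hk : ∀ c : k, algebraMap k K c ∈ O) (hN : Algebra.trdeg k K < ℵ₀) :
    residueTrdeg k O hk < ℵ₀ :=
  (le_add_self.trans (ratRank_add_residueTrdeg_le_trdeg O hk)).trans_lt hN

/-- **`D + E + F = N`** (Temkin 2013, §2.1, p. 10: "when `N` is finite we define the
transcendence defect `D = D_{l/k} = N - E - F`"): for `tr.deg._k(K) < ℵ₀` the truncated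
natural-number rendering `transcendenceDefect` is the printed `D`. [cite: Temkin2013, Section 2.1 (p. 10)] -/
theorem transcendenceDefect_add_eq (hk : ∀ c : k, algebraMap k K c ∈ O)
    (hN : Algebra.trdeg k K < ℵ₀) :
    (transcendenceDefect k O hk : Cardinal) + ratRank O + residueTrdeg k O hk =
      Algebra.trdeg k K := by
  obtain ⟨N, hNn⟩ := Cardinal.lt_aleph0.mp hN
  obtain ⟨E, hE⟩ := Cardinal.lt_aleph0.mp (ratRank_lt_aleph0 O hk hN)
  obtain ⟨F, hF⟩ := Cardinal.lt_aleph0.mp (residueTrdeg_lt_aleph0 O hk hN)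
  have hle := ratRank_add_residueTrdeg_le_trdeg O hk
  unfold transcendenceDefect
  rw [hE, hF, hNn] at hle ⊢
  simp only [Cardinal.toNat_natCast]
  norm_cast at hle ⊢
  omega

/-- `D + E + F = N` in natural numbers. [folklore] -/
theorem transcendenceDefect_add_toNat_eq (hk : ∀ c : k, algebraMap k K c ∈ O)
    (hN : Algebra.trdeg k K < ℵ₀) :
    transcendenceDefect k O hk + Cardinal.toNat (ratRank O) +
      Cardinal.toNat (residueTrdeg k O hk) = Cardinal.toNat (Algebra.trdeg k K) := by
  have h := congrArg Cardinal.toNat (transcendenceDefect_add_eq O hk hN)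
  rwa [Cardinal.toNat_add (by simpa using (add_lt_aleph0 (natCast_lt_aleph0)
      (ratRank_lt_aleph0 O hk hN))) (residueTrdeg_lt_aleph0 O hk hN),
    Cardinal.toNat_add (natCast_lt_aleph0) (ratRank_lt_aleph0 O hk hN),
    Cardinal.toNat_natCast] at h

/-- **`D = 0 ↔ E + F = N`** for finite `N`: the arithmetic behind Temkin's remark "for a
finite `N` the extension is Abhyankar if and only if `D_{l/k} = 0`" (§2.1, p. 10); the
Abhyankar predicate itself (a transcendence basis satisfying (*)) is not rendered in this file,
so only this numerical form is stated. [folklore] -/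
theorem transcendenceDefect_eq_zero_iff (hk : ∀ c : k, algebraMap k K c ∈ O)
    (hN : Algebra.trdeg k K < ℵ₀) :
    transcendenceDefect k O hk = 0 ↔ ratRank O + residueTrdeg k O hk = Algebra.trdeg k K := by
  constructor
  · intro h
    have := transcendenceDefect_add_eq O hk hN
    rw [h, Nat.cast_zero, zero_add] at this
    exact this
  · intro h
    obtain ⟨N, hNn⟩ := Cardinal.lt_aleph0.mp hN
    obtain ⟨E, hE⟩ := Cardinal.lt_aleph0.mp (ratRank_lt_aleph0 O hk hN)
    obtain ⟨F, hF⟩ := Cardinal.lt_aleph0.mp (residueTrdeg_lt_aleph0 O hk hN)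
    unfold transcendenceDefect
    rw [hE, hF, hNn] at h ⊢
    simp only [Cardinal.toNat_natCast]
    norm_cast at h
    omega

end inequality

/-! ### The trivial valuation: `E = 0`, `F = N`, `D = 0` -/

section trivial

variable {k}

/-- The value group of the trivial valuation ring `O = K` is trivial. [folklore] -/
theorem units_valueGroup_top_eq_one
    (u : (ValuationSubring.ValueGroup (⊤ : ValuationSubring K))ˣ) : u = 1 := by
  obtain ⟨x, hx⟩ := (⊤ : ValuationSubring K).valuation_surjective
    (u : ValuationSubring.ValueGroup (⊤ : ValuationSubring K))
  have hx0 : x ≠ 0 := by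
    rintro rfl
    rw [map_zero] at hx
    exact u.ne_zero hx.symm
  apply Units.ext
  rw [← hx, Units.val_one]
  have hunit : IsUnit (⟨x, ValuationSubring.mem_top x⟩ : (⊤ : ValuationSubring K)) :=
    IsUnit.of_mul_eq_one (b := ⟨x⁻¹, ValuationSubring.mem_top _⟩)
      (Subtype.ext (mul_inv_cancel₀ hx0))
  exact (ValuationSubring.valuation_eq_one_iff _ _).mp hunit

/-- `E = 0` for the trivial valuation. [folklore] -/
theorem ratRank_top : ratRank (⊤ : ValuationSubring K) = 0 := by
  haveI : Subsingleton (ValuationSubring.ValueGroup (⊤ : ValuationSubring K))ˣ :=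
    ⟨fun a b => by rw [units_valueGroup_top_eq_one a, units_valueGroup_top_eq_one b]⟩
  unfold ratRank
  exact rank_subsingleton' ℤ _

/-- `F = N` for the trivial valuation: the residue field of `O = K` is `K`. [folklore] -/
theorem residueTrdeg_top (hk : ∀ c : k, algebraMap k K c ∈ (⊤ : ValuationSubring K)) :
    residueTrdeg k ⊤ hk = Algebra.trdeg k K := by
  letI := algebraOfMem k ⊤ hk
  haveI := isScalarTower_algebraOfMem k (⊤ : ValuationSubring K) hk
  show Algebra.trdeg k (ResidueField (⊤ : ValuationSubring K)) = _
  let ψ : K →+* ResidueField (⊤ : ValuationSubring K) :=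
    (residue _).comp ((RingHom.id K).codRestrict (⊤ : ValuationSubring K)
      ValuationSubring.mem_top)
  let φ : K →ₐ[k] ResidueField (⊤ : ValuationSubring K) := { ψ with commutes' := fun _ => rfl }
  have hinj : Function.Injective φ := ψ.injective
  have hsurj : Function.Surjective φ := by
    intro r
    obtain ⟨a, rfl⟩ := residue_surjective r
    exact ⟨a.1, rfl⟩
  exact le_antisymm (trdeg_le_of_surjective φ hsurj) (trdeg_le_of_injective φ hinj)

/-- `D = 0` for the trivial valuation (it is Abhyankar). [folklore] -/
theorem transcendenceDefect_top (hk : ∀ c : k, algebraMap k K c ∈ (⊤ : ValuationSubring K)) :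
    transcendenceDefect k ⊤ hk = 0 := by
  unfold transcendenceDefect
  rw [ratRank_top, residueTrdeg_top]
  simp

end trivial

end Literature.AlgebraicGeometry.Resolution
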